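import Mathlib
import Literature.Computability.AlgebraicComplexity.RealTauKnownCases

/-!
# `MatrixDescartes` census — the TANGENCY BUDGET: a real polynomial touches zero from one side at few points

HONEST FRAMING.  Object-search cell `pub-symmetroid`, door-A seat `val-sym-door-p1` (g13); helper beside the OPEN typed statements
`DoorA26` (stmt-ValiantsHypothesis-19979) / `DoorA34` (19980), asserted nowhere.  This is the elementary counting half of the tangency
budget of `…CensusExteriorTangentSupport` (report DOOR-A-P1-REPORT §66 (c)): there, every shallow return excursion of a hypothetical twenty
produces a six-nomial `h = tr(W₀ F)` that is `≥ 0` on the excursion with a zero inside (a TOUCH) and is positive on all definite gaps of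
its type.  Here: (1) `two_le_rootMultiplicity_of_touch` — a zero of a non-zero real polynomial at which the polynomial keeps a weak sign on a
neighbourhood has multiplicity `≥ 2`; (2) `sum_rootMultiplicity_le_signVariations` — over any finite set of positive roots the multiplicities
add up to at most the number of coefficient sign changes (Descartes' rule with multiplicity, Mathlib), hence to at most `#support − 1`;
(3) `card_touches_le` — so a polynomial with at most `n + 1` monomials touches zero from one side at no more than `n / 2` positive points;
a six-nomial at no more than `2` (`card_touches_le_two_of_card_support_le_six`).  Pure polynomial facts, any degree, any support; nothing
here bounds `ζ_sym(2,6)`/`ζ_sym(3,4)`, decides `DoorA26`/`DoorA34`, or bears on `MatrixDescartes` (stmt-ValiantsHypothesis-18050) / `VP ≠ VNP`.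

[folklore] Factor theorem + continuity; Descartes' rule of signs with multiplicity (`Polynomial.roots_countP_pos_le_signVariations`).
-/

-- `Summit.ValiantsHypothesis.ValiantsHypothesis.…` repeats a component by the D-0017 layout
-- (single-conjunct summit), which the `dupNamespace` linter flags; the name is mandated.
set_option linter.dupNamespace false

namespace Summit.ValiantsHypothesis.ValiantsHypothesis.Theorems.LacunarySymmetroidMatrixDescartes.Census

open Polynomial Set Finset
open scoped BigOperators Topology

/-- **A touch is a root of multiplicity ≥ 2.**  If `p ≠ 0` vanishes at `z` and is `≥ 0` on an open interval around `z`, then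
`2 ≤ rootMultiplicity z p`. [folklore] -/
theorem two_le_rootMultiplicity_of_touch {p : ℝ[X]} (hp : p ≠ 0) {a z b : ℝ} (haz : a < z) (hzb : z < b)
    (hroot : p.eval z = 0) (hnn : ∀ y ∈ Ioo a b, 0 ≤ p.eval y) : 2 ≤ p.rootMultiplicity z := by
  have h1 : 0 < p.rootMultiplicity z := (Polynomial.rootMultiplicity_pos hp).mpr hroot
  by_contra hlt
  have hm : p.rootMultiplicity z = 1 := by omega
  -- factor `p = (X − z) · q` with `q(z) ≠ 0`
  obtain ⟨q, hpq, hq⟩ := p.exists_eq_pow_rootMultiplicity_mul_and_not_dvd hp z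
  rw [hm, pow_one] at hpq
  have hqz : q.eval z ≠ 0 := fun h0 => hq (Polynomial.dvd_iff_isRoot.mpr h0)
  have hev : ∀ y, p.eval y = (y - z) * q.eval y := fun y => by
    rw [hpq, Polynomial.eval_mul, Polynomial.eval_sub, Polynomial.eval_X, Polynomial.eval_C]
  -- `q` keeps the sign of `q(z)` near `z`
  have hcont : ContinuousAt (fun y => q.eval y) z := q.continuous.continuousAt
  rcases lt_or_gt_of_ne hqz with hneg | hpos
  · have hev' : ∀ᶠ y in 𝓝 z, q.eval y < 0 := hcont.eventually (gt_mem_nhds hneg)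
    obtain ⟨δ, hδ, hball⟩ := Metric.eventually_nhds_iff.mp hev'
    -- a point slightly to the LEFT of `z`: `p = (y − z) q(y) > 0`?  No: `(y - z) < 0`, `q < 0` ⇒ `p > 0` — fine; to the RIGHT: `p < 0`.
    set y := z + min (δ / 2) ((b - z) / 2) with hy
    have hyz : z < y := by rw [hy]; have := lt_min (half_pos hδ) (half_pos (sub_pos.mpr hzb)); linarith
    have hyb : y < b := by
      rw [hy]; have := min_le_right (δ / 2) ((b - z) / 2); linarith
    have hyd : dist y z < δ := by
      rw [Real.dist_eq, hy, add_sub_cancel_left, abs_of_pos (lt_min (half_pos hδ) (half_pos (sub_pos.mpr hzb)))]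
      have := min_le_left (δ / 2) ((b - z) / 2); linarith
    have hqy : q.eval y < 0 := hball hyd
    have hpy : p.eval y < 0 := by rw [hev]; exact mul_neg_of_pos_of_neg (sub_pos.mpr hyz) hqy
    have := hnn y ⟨lt_trans haz hyz, hyb⟩
    linarith
  · have hev' : ∀ᶠ y in 𝓝 z, 0 < q.eval y := hcont.eventually (lt_mem_nhds hpos)
    obtain ⟨δ, hδ, hball⟩ := Metric.eventually_nhds_iff.mp hev'
    set y := z - min (δ / 2) ((z - a) / 2) with hy
    have hyz : y < z := by rw [hy]; have := lt_min (half_pos hδ) (half_pos (sub_pos.mpr haz)); linarith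
    have hay : a < y := by
      rw [hy]; have := min_le_right (δ / 2) ((z - a) / 2); linarith
    have hyd : dist y z < δ := by
      rw [Real.dist_eq, hy, sub_sub_cancel_left, abs_neg,
        abs_of_pos (lt_min (half_pos hδ) (half_pos (sub_pos.mpr haz)))]
      have := min_le_left (δ / 2) ((z - a) / 2); linarith
    have hqy : 0 < q.eval y := hball hyd
    have hpy : p.eval y < 0 := by rw [hev]; exact mul_neg_of_neg_of_pos (sub_neg.mpr hyz) hqy
    have := hnn y ⟨hay, lt_trans hyz hzb⟩
    linarith

/-- **Multiplicities of positive roots add up to at most the number of sign changes** (Descartes' rule with multiplicity):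
for `p ≠ 0` and a finite set `Z` of positive roots, `Σ_{z ∈ Z} mult(z) ≤ signVariations p < #support p`. [folklore] -/
theorem sum_rootMultiplicity_le_signVariations {p : ℝ[X]} (hp : p ≠ 0) (Z : Finset ℝ)
    (hZ : ∀ z ∈ Z, 0 < z ∧ p.eval z = 0) :
    ∑ z ∈ Z, p.rootMultiplicity z ≤ p.signVariations := by
  classical
  set s : Multiset ℝ := p.roots.filter (fun x => 0 < x) with hs
  have hcount : ∀ z ∈ Z, p.rootMultiplicity z = s.count z := by
    intro z hz
    rw [hs, Multiset.count_filter_of_pos (hZ z hz).1, Polynomial.count_roots]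
  have hsub : Z ⊆ s.toFinset := by
    intro z hz
    rw [Multiset.mem_toFinset, hs, Multiset.mem_filter, Polynomial.mem_roots hp]
    exact ⟨(hZ z hz).2, (hZ z hz).1⟩
  calc ∑ z ∈ Z, p.rootMultiplicity z = ∑ z ∈ Z, s.count z := Finset.sum_congr rfl hcount
    _ ≤ ∑ z ∈ s.toFinset, s.count z := Finset.sum_le_sum_of_subset_of_nonneg hsub fun _ _ _ => Nat.zero_le _
    _ = Multiset.card s := Multiset.toFinset_sum_count_eq s
    _ = p.roots.countP (fun x => 0 < x) := by rw [hs, Multiset.countP_eq_card_filter]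
    _ ≤ p.signVariations := p.roots_countP_pos_le_signVariations

/-- **TANGENCY BUDGET.**  A non-zero real polynomial that touches zero from above (`p ≥ 0` on a neighbourhood of each zero) at the
points of a finite set `Z ⊂ (0, ∞)` satisfies `2·#Z + 1 ≤ #support p`; the same for touches from below by `p ↦ −p`. [folklore] -/
theorem card_touches_le {p : ℝ[X]} (hp : p ≠ 0) (Z : Finset ℝ)
    (hZ : ∀ z ∈ Z, 0 < z ∧ p.eval z = 0 ∧ ∃ a b : ℝ, a < z ∧ z < b ∧ ∀ y ∈ Ioo a b, 0 ≤ p.eval y) :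
    2 * Z.card + 1 ≤ p.support.card := by
  have h2 : ∀ z ∈ Z, 2 ≤ p.rootMultiplicity z := by
    intro z hz
    obtain ⟨-, hroot, a, b, haz, hzb, hnn⟩ := hZ z hz
    exact two_le_rootMultiplicity_of_touch hp haz hzb hroot hnn
  have hsum : 2 * Z.card ≤ ∑ z ∈ Z, p.rootMultiplicity z := by
    calc 2 * Z.card = ∑ _z ∈ Z, 2 := by rw [Finset.sum_const, smul_eq_mul, mul_comm]
      _ ≤ ∑ z ∈ Z, p.rootMultiplicity z := Finset.sum_le_sum h2
  have hsv := sum_rootMultiplicity_le_signVariations hp Z fun z hz => ⟨(hZ z hz).1, (hZ z hz).2.1⟩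
  have hsupp := Literature.Computability.AlgebraicComplexity.signVariations_lt_card_support hp
  omega

/-- Touches from BELOW (`p ≤ 0` near each zero): the same budget. [folklore] -/
theorem card_touches_le' {p : ℝ[X]} (hp : p ≠ 0) (Z : Finset ℝ)
    (hZ : ∀ z ∈ Z, 0 < z ∧ p.eval z = 0 ∧ ∃ a b : ℝ, a < z ∧ z < b ∧ ∀ y ∈ Ioo a b, p.eval y ≤ 0) :
    2 * Z.card + 1 ≤ p.support.card := by
  have h := card_touches_le (p := -p) (neg_ne_zero.mpr hp) Z (fun z hz => by
    obtain ⟨h0, hroot, a, b, haz, hzb, hnn⟩ := hZ z hz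
    exact ⟨h0, by rw [Polynomial.eval_neg, hroot, neg_zero], a, b, haz, hzb,
      fun y hy => by rw [Polynomial.eval_neg]; linarith [hnn y hy]⟩)
  rwa [Polynomial.support_neg] at h

/-- The six-nomial case (the supporting circles of `…CensusExteriorTangentSupport`): a non-zero real polynomial with at most six
monomials touches zero from one side at no more than TWO positive points. [folklore] -/
theorem card_touches_le_two_of_card_support_le_six {p : ℝ[X]} (hp : p ≠ 0) (h6 : p.support.card ≤ 6) (Z : Finset ℝ)
    (hZ : ∀ z ∈ Z, 0 < z ∧ p.eval z = 0 ∧ ∃ a b : ℝ, a < z ∧ z < b ∧ ∀ y ∈ Ioo a b, 0 ≤ p.eval y) :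
    Z.card ≤ 2 := by
  have := card_touches_le hp Z hZ
  omega

end Summit.ValiantsHypothesis.ValiantsHypothesis.Theorems.LacunarySymmetroidMatrixDescartes.Census
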